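import Mathlib
import Summits.Ventures.PercRepro2.MixChordOStarConn

/-!
# The four worlds of the `o`–ROOT STAR: pins and `a₃`-free events (blind cell PercRepro2, night-1 g24;
proofs/NIGHT1-G24.md §3)

`a₃` has exactly the two edges `g = {a₃, o}` (weight `r`) and `e = {a₃, a₁}` (weight `t`); `f = {o, a₁}` is
the `o`-edge.  The four worlds are `p[g ↦ c₁][e ↦ c₂]`; their probabilities are preimage probabilities under
`p` (`prob_w10`, `prob_w01`, `prob_w11`, `prob_w00`, `prob_w00f`), read through the BASE configuration
`ω₀ = ω[g ↦ 0][e ↦ 0]` (`upd10`, `upd01`, `upd11`).  An event is `a₃`-FREE when it reads the same way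
in every world — on `ω₀` when at most one edge is open (`a3Free_connEvent` for a connection among vertices
other than `a₃`, `a3Free_inter`, `a3Free_univ`), on `ω₀[f ↦ 1]` (the `o`-edge OPENED) when both are
(`a3FreeF_connEvent`, `a3FreeF_inter`, `a3FreeF_univ`); the two readings are spelled out as hypotheses.  The
readings `r10`, `r10a`, `r10a'`, `r01`, `r01a`, `r01a'`, `r11`, `r11a`, `r11a'`, `r00a`, `r00a'` are the
connectivity lemmas of MixChordOStarConn.lean in the form in which the events unfold.  Own code; standard
axioms.
-/

namespace Summit.Ventures.PercRepro2

open UnionCluster CovForm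

namespace Mix

namespace OStar

/-! ## The four worlds of the `o`–root star: pins and `a₃`-free events -/

section Pins

variable {V : Type*} {E : Type*} [Fintype E] [DecidableEq E] {R : Type*} [Field R]

variable {ends : E → Sym2 V} {g e f : E} {o a₁ a₂ a₃ : V}

omit [Fintype E] in
/-- `ω[g ↦ 1][e ↦ 0]` through the base configuration `ω₀ = ω[g ↦ 0][e ↦ 0]`. -/
lemma upd10 (hge : g ≠ e) (ω : Config E) :
    Function.update (Function.update ω g true) e false =
      Function.update (Function.update (Function.update ω g false) e false) g true := by
  rw [Function.update_comm hge.symm, Function.update_idem]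

omit [Fintype E] in
/-- `ω[g ↦ 0][e ↦ 1]` through the base configuration. -/
lemma upd01 (ω : Config E) :
    Function.update (Function.update ω g false) e true =
      Function.update (Function.update (Function.update ω g false) e false) e true := by
  rw [Function.update_idem]

omit [Fintype E] in
/-- `ω[g ↦ 1][e ↦ 1]` through the base configuration. -/
lemma upd11 (hge : g ≠ e) (ω : Config E) :
    Function.update (Function.update ω g true) e true =
      Function.update (Function.update (Function.update (Function.update ω g false) e false) g true) e true := by
  rw [← upd10 hge, Function.update_idem]

omit [Fintype E] in
/-- The base configuration has `g` closed. -/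
lemma base_g (hge : g ≠ e) (ω : Config E) :
    Function.update (Function.update ω g false) e false g = false := by
  rw [Function.update_of_ne hge, Function.update_self]

omit [Fintype E] in
/-- The base configuration has `e` closed. -/
lemma base_e (ω : Config E) : Function.update (Function.update ω g false) e false e = false := by
  rw [Function.update_self]

variable (p : E → R)

/-- `P_{p[g↦1][e↦0]}(A) = P_p {ω ∣ ω[g↦1][e↦0] ∈ A}`. -/
lemma prob_w10 (A : Set (Config E)) :
    prob (Function.update (Function.update p g 1) e 0) A =
      prob p {ω | Function.update (Function.update ω g true) e false ∈ A} := by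
  rw [CCT.prob_update_zero_eq, CCT.prob_update_one_eq]
  rfl

/-- `P_{p[g↦0][e↦1]}(A) = P_p {ω ∣ ω[g↦0][e↦1] ∈ A}`. -/
lemma prob_w01 (A : Set (Config E)) :
    prob (Function.update (Function.update p g 0) e 1) A =
      prob p {ω | Function.update (Function.update ω g false) e true ∈ A} := by
  rw [CCT.prob_update_one_eq, CCT.prob_update_zero_eq]
  rfl

/-- `P_{p[g↦1][e↦1]}(A) = P_p {ω ∣ ω[g↦1][e↦1] ∈ A}`. -/
lemma prob_w11 (A : Set (Config E)) :
    prob (Function.update (Function.update p g 1) e 1) A =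
      prob p {ω | Function.update (Function.update ω g true) e true ∈ A} := by
  rw [CCT.prob_update_one_eq, CCT.prob_update_one_eq]
  rfl

/-- `P_{p[g↦0][e↦0]}(A) = P_p {ω ∣ ω[g↦0][e↦0] ∈ A}`. -/
lemma prob_w00 (A : Set (Config E)) :
    prob (Function.update (Function.update p g 0) e 0) A =
      prob p {ω | Function.update (Function.update ω g false) e false ∈ A} := by
  rw [CCT.prob_update_zero_eq, CCT.prob_update_zero_eq]
  rfl

/-- `P_{p[g↦0][e↦0][f↦1]}(A) = P_p {ω ∣ ω[g↦0][e↦0][f↦1] ∈ A}`. -/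
lemma prob_w00f (A : Set (Config E)) :
    prob (Function.update (Function.update (Function.update p g 0) e 0) f 1) A =
      prob p {ω | Function.update (Function.update (Function.update ω g false) e false) f true ∈ A} := by
  rw [CCT.prob_update_one_eq, CCT.prob_update_zero_eq, CCT.prob_update_zero_eq]
  rfl

omit [Fintype E] in
/-- `univ` is `a₃`-free. -/
lemma a3Free_univ : (∀ ω : Config E,
      (Function.update (Function.update ω g true) e false ∈ (Set.univ : Set (Config E)) ↔
          Function.update (Function.update ω g false) e false ∈ (Set.univ : Set (Config E))) ∧
      (Function.update (Function.update ω g false) e true ∈ (Set.univ : Set (Config E)) ↔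
          Function.update (Function.update ω g false) e false ∈ (Set.univ : Set (Config E)))) := fun _ => by simp

omit [Fintype E] in
/-- `univ` is `a₃`-free with both edges open. -/
lemma a3FreeF_univ : (∀ ω : Config E,
      Function.update (Function.update ω g true) e true ∈ (Set.univ : Set (Config E)) ↔
        Function.update (Function.update (Function.update ω g false) e false) f true ∈ (Set.univ : Set (Config E))) := fun _ => by simp

omit [Fintype E] in
/-- Intersections of `a₃`-free events are `a₃`-free. -/
lemma a3Free_inter {X Y : Set (Config E)} (hX : (∀ ω : Config E,
      (Function.update (Function.update ω g true) e false ∈ X ↔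
          Function.update (Function.update ω g false) e false ∈ X) ∧
      (Function.update (Function.update ω g false) e true ∈ X ↔
          Function.update (Function.update ω g false) e false ∈ X))) (hY : (∀ ω : Config E,
      (Function.update (Function.update ω g true) e false ∈ Y ↔
          Function.update (Function.update ω g false) e false ∈ Y) ∧
      (Function.update (Function.update ω g false) e true ∈ Y ↔
          Function.update (Function.update ω g false) e false ∈ Y))) :
    (∀ ω : Config E,
      (Function.update (Function.update ω g true) e false ∈ (X ∩ Y) ↔
          Function.update (Function.update ω g false) e false ∈ (X ∩ Y)) ∧
      (Function.update (Function.update ω g false) e true ∈ (X ∩ Y) ↔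
          Function.update (Function.update ω g false) e false ∈ (X ∩ Y))) := fun ω => by
  obtain ⟨h1, h2⟩ := hX ω
  obtain ⟨k1, k2⟩ := hY ω
  simp only [Set.mem_inter_iff]
  exact ⟨and_congr h1 k1, and_congr h2 k2⟩

omit [Fintype E] in
/-- Intersections of events `a₃`-free with both edges open are so. -/
lemma a3FreeF_inter {X Y : Set (Config E)} (hX : (∀ ω : Config E,
      Function.update (Function.update ω g true) e true ∈ X ↔
        Function.update (Function.update (Function.update ω g false) e false) f true ∈ X)) (hY : (∀ ω : Config E,
      Function.update (Function.update ω g true) e true ∈ Y ↔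
        Function.update (Function.update (Function.update ω g false) e false) f true ∈ Y)) :
    (∀ ω : Config E,
      Function.update (Function.update ω g true) e true ∈ (X ∩ Y) ↔
        Function.update (Function.update (Function.update ω g false) e false) f true ∈ (X ∩ Y)) := fun ω => by
  simp only [Set.mem_inter_iff]
  exact and_congr (hX ω) (hY ω)

omit [Fintype E] in
/-- A connection between two vertices other than `a₃` is `a₃`-free. -/
lemma a3Free_connEvent (hg : ends g = s(a₃, o)) (he : ends e = s(a₃, a₁))
    (hstar : ∀ e', a₃ ∈ ends e' → e' = g ∨ e' = e) (hge : g ≠ e) {x y : V} (hx : x ≠ a₃) (hy : y ≠ a₃) :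
    (∀ ω : Config E,
      (Function.update (Function.update ω g true) e false ∈ (connEvent ends x y) ↔
          Function.update (Function.update ω g false) e false ∈ (connEvent ends x y)) ∧
      (Function.update (Function.update ω g false) e true ∈ (connEvent ends x y) ↔
          Function.update (Function.update ω g false) e false ∈ (connEvent ends x y))) := fun ω => by
  have h0g := base_g (e := e) hge ω
  have h0e := base_e (g := g) (e := e) ω
  refine ⟨?_, ?_⟩
  · rw [upd10 hge]
    exact conn_update_g_iff hg hstar h0g h0e hx hy
  · rw [upd01]
    exact conn_update_e_iff he hstar h0g h0e hx hy

omit [Fintype E] in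
/-- A connection between two vertices other than `a₃` is `a₃`-free with both edges open. -/
lemma a3FreeF_connEvent (hg : ends g = s(a₃, o)) (he : ends e = s(a₃, a₁))
    (hstar : ∀ e', a₃ ∈ ends e' → e' = g ∨ e' = e) (hf : ends f = s(o, a₁))
    (hge : g ≠ e) (hgf : g ≠ f) (hef : e ≠ f) {x y : V} (hx : x ≠ a₃) (hy : y ≠ a₃) :
    (∀ ω : Config E,
      Function.update (Function.update ω g true) e true ∈ (connEvent ends x y) ↔
        Function.update (Function.update (Function.update ω g false) e false) f true ∈ (connEvent ends x y)) := fun ω => by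
  have h0g := base_g (e := e) hge ω
  have h0e := base_e (g := g) (e := e) ω
  rw [upd11 hge]
  exact conn_update_ge_iff hg he hstar hf hge hgf hef h0g h0e hx hy

end Pins

/-! ## The readings of `Q`, `PD`, `T`, `T′` in the four worlds -/

section Readings

variable {V : Type*} {E : Type*} [Fintype E] [DecidableEq E] {R : Type*} [Field R]

variable {ends : E → Sym2 V} {g e f : E} {o a₁ a₂ a₃ : V}

omit [Fintype E] [DecidableEq E] in
/-- Membership in `Q = {a₂ ↮ a₁}`. -/
lemma mem_Q_iff {ω : Config E} : ω ∈ avoidAll ends a₂ {a₁} ↔ ¬ Conn ends ω a₂ a₁ := by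
  simp [mem_avoidAll]

omit [Fintype E] [DecidableEq E] in
/-- Membership in `Q`, with the connection written from `a₁`. -/
lemma mem_Q_iff' {ω : Config E} : ω ∈ avoidAll ends a₂ {a₁} ↔ ¬ Conn ends ω a₁ a₂ := by
  rw [mem_Q_iff]
  exact not_congr ⟨conn_symm, conn_symm⟩

omit [Fintype E] [DecidableEq E] in
/-- Membership in `PD_v = Q ∩ {v ∉ U}`. -/
lemma mem_PD_iff {ω : Config E} {v : V} : ω ∈ PDEvent ends a₁ a₂ v ↔
    ¬ Conn ends ω a₁ a₂ ∧ ¬ Conn ends ω v a₁ ∧ ¬ Conn ends ω v a₂ := by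
  simp [PDEvent, Dtilde, UnionCluster.mem_inU, not_or]

omit [Fintype E] [DecidableEq E] in
/-- Membership in `T_v = Q ∩ {v ∈ C₂}`. -/
lemma mem_T_iff {ω : Config E} {v : V} : ω ∈ TEvent ends a₁ a₂ v ↔
    ¬ Conn ends ω a₂ a₁ ∧ Conn ends ω a₂ v := by
  simp [TEvent]

/-! The connection readings, in the form in which they appear after unfolding the events. -/

variable (hg : ends g = s(a₃, o)) (he : ends e = s(a₃, a₁))
  (hstar : ∀ e', a₃ ∈ ends e' → e' = g ∨ e' = e) (hf : ends f = s(o, a₁))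
  (hge : g ≠ e) (hgf : g ≠ f) (hef : e ≠ f)

omit [Fintype E] in
include hg hstar hge in
/-- World `(1, 0)`: connections among vertices other than `a₃` read on the base configuration. -/
lemma r10 (ω : Config E) {x y : V} (hx : x ≠ a₃) (hy : y ≠ a₃) :
    Conn ends (Function.update (Function.update ω g true) e false) x y ↔
      Conn ends (Function.update (Function.update ω g false) e false) x y := by
  rw [upd10 hge]; exact conn_update_g_iff hg hstar (base_g hge ω) (base_e ω) hx hy

omit [Fintype E] in
include hg hstar hge in
/-- World `(1, 0)`: `x ↔ a₃` reads as `x ↔ o` on the base configuration. -/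
lemma r10a (ω : Config E) {x : V} (hx : x ≠ a₃) :
    Conn ends (Function.update (Function.update ω g true) e false) x a₃ ↔
      Conn ends (Function.update (Function.update ω g false) e false) x o := by
  rw [upd10 hge]; exact conn_a3_update_g_iff hg hstar (base_g hge ω) (base_e ω) hx

omit [Fintype E] in
include hg hstar hge in
/-- World `(1, 0)`: `a₃ ↔ x` reads as `o ↔ x` on the base configuration. -/
lemma r10a' (ω : Config E) {x : V} (hx : x ≠ a₃) :
    Conn ends (Function.update (Function.update ω g true) e false) a₃ x ↔
      Conn ends (Function.update (Function.update ω g false) e false) o x := by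
  rw [← (⟨conn_symm, conn_symm⟩ : Conn ends _ x a₃ ↔ Conn ends _ a₃ x), r10a hg hstar hge ω hx]
  exact ⟨conn_symm, conn_symm⟩

omit [Fintype E] in
include he hstar hge in
/-- World `(0, 1)`: connections among vertices other than `a₃` read on the base configuration. -/
lemma r01 (ω : Config E) {x y : V} (hx : x ≠ a₃) (hy : y ≠ a₃) :
    Conn ends (Function.update (Function.update ω g false) e true) x y ↔
      Conn ends (Function.update (Function.update ω g false) e false) x y := by
  rw [upd01]; exact conn_update_e_iff he hstar (base_g hge ω) (base_e ω) hx hy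

omit [Fintype E] in
include he hstar hge in
/-- World `(0, 1)`: `x ↔ a₃` reads as `x ↔ a₁` on the base configuration. -/
lemma r01a (ω : Config E) {x : V} (hx : x ≠ a₃) :
    Conn ends (Function.update (Function.update ω g false) e true) x a₃ ↔
      Conn ends (Function.update (Function.update ω g false) e false) x a₁ := by
  rw [upd01]; exact conn_a3_update_e_iff he hstar (base_g hge ω) (base_e ω) hx

omit [Fintype E] in
include he hstar hge in
/-- World `(0, 1)`: `a₃ ↔ x` reads as `a₁ ↔ x` on the base configuration. -/
lemma r01a' (ω : Config E) {x : V} (hx : x ≠ a₃) :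
    Conn ends (Function.update (Function.update ω g false) e true) a₃ x ↔
      Conn ends (Function.update (Function.update ω g false) e false) a₁ x := by
  rw [← (⟨conn_symm, conn_symm⟩ : Conn ends _ x a₃ ↔ Conn ends _ a₃ x), r01a he hstar hge ω hx]
  exact ⟨conn_symm, conn_symm⟩

omit [Fintype E] in
include hg he hstar hf hge hgf hef in
/-- World `(1, 1)`: connections among vertices other than `a₃` read on the base configuration with `f` opened. -/
lemma r11 (ω : Config E) {x y : V} (hx : x ≠ a₃) (hy : y ≠ a₃) :
    Conn ends (Function.update (Function.update ω g true) e true) x y ↔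
      Conn ends (Function.update (Function.update (Function.update ω g false) e false) f true) x y := by
  rw [upd11 hge]; exact conn_update_ge_iff hg he hstar hf hge hgf hef (base_g hge ω) (base_e ω) hx hy

omit [Fintype E] in
include hg he hstar hf hge hgf hef in
/-- World `(1, 1)`: `x ↔ a₃` reads as `x ↔ a₁` on the base configuration with `f` opened. -/
lemma r11a (h31 : a₃ ≠ a₁) (ω : Config E) {x : V} (hx : x ≠ a₃) :
    Conn ends (Function.update (Function.update ω g true) e true) x a₃ ↔
      Conn ends (Function.update (Function.update (Function.update ω g false) e false) f true) x a₁ := by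
  rw [upd11 hge]; exact conn_a3_update_ge_iff hg he hstar hf hge hgf hef h31 (base_g hge ω) (base_e ω) hx

omit [Fintype E] in
include hg he hstar hf hge hgf hef in
/-- World `(1, 1)`: `a₃ ↔ x` reads as `a₁ ↔ x` on the base configuration with `f` opened. -/
lemma r11a' (h31 : a₃ ≠ a₁) (ω : Config E) {x : V} (hx : x ≠ a₃) :
    Conn ends (Function.update (Function.update ω g true) e true) a₃ x ↔
      Conn ends (Function.update (Function.update (Function.update ω g false) e false) f true) a₁ x := by
  rw [← (⟨conn_symm, conn_symm⟩ : Conn ends _ x a₃ ↔ Conn ends _ a₃ x),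
    r11a hg he hstar hf hge hgf hef h31 ω hx]
  exact ⟨conn_symm, conn_symm⟩

omit [Fintype E] in
include hstar hge in
/-- World `(0, 0)`: `a₃` is isolated. -/
lemma r00a (ω : Config E) {x : V} (hx : x ≠ a₃) :
    Conn ends (Function.update (Function.update ω g false) e false) x a₃ ↔ False :=
  iff_false_intro (not_conn_a3_of_closed hstar (base_g hge ω) (base_e ω) hx)

omit [Fintype E] in
include hstar hge in
/-- World `(0, 0)`: `a₃` is isolated (other orientation). -/
lemma r00a' (ω : Config E) {x : V} (hx : x ≠ a₃) :
    Conn ends (Function.update (Function.update ω g false) e false) a₃ x ↔ False :=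
  iff_false_intro fun h => not_conn_a3_of_closed hstar (base_g hge ω) (base_e ω) hx (conn_symm h)

end Readings

end OStar

end Mix

end Summit.Ventures.PercRepro2
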